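import Summits.SmoothPoincare4.SmoothPoincare4.Theorems.CongruenceShadowsHeegaardHandlebodyCongruenceClosedClosedKernels

/-!
# Principal left-factor families are honest products — crux `CongruenceShadows.HeegaardHandlebodyCongruenceClosed`
(item stmt-SmoothPoincare4-14596), line `pair-rigidity-retraction`, registered helper stub
`stub_isProductOfPrincipalLeftFamily` (the "left criterion")

Notation: `S = S_{3+3m} = SurfaceGroup (3+3m)`, `N = (N₀,N₁,N₂) = s4Kernels.stabilizeIter m`,
`H = Stab N₀ ∩ Stab N₁`, `C = Stab N₂` (in `Aut S`); "`φ ≡ d (mod M)`" is the pointwise congruence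
`∀ s, φ s * (d s)⁻¹ ∈ M`; `M` ranges over the characteristic finite-index subgroups of `S` ("levels").

* Congruence calculus modulo a characteristic `M` (general group `G`): congruences compose
  (`congr_comp`), pass to inverses (`congr_symm`) and can be divided on the left by an automorphism
  (`symm_apply_mul_inv_mem`); stabilisers of a subgroup are closed under `symm`/`trans`.
* `map_le_of_congr_of_closed`, `map_eq_of_congr_of_closed` — if `K ≤ G` is CLOSED in the characteristic profinite
  topology (`⋂_M K ⊔ M = K`) and `φ` is congruent at every level to SOME element of `Stab K`, then `φ ∈ Stab K`.
* `isProduct_of_principalLeftFamily` — the LEFT CRITERION: let `x ∈ H`; if at every level `M` the product-congruence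
  `ρ ≡ y_M ∘ c_M (mod M)` (`c_M ∈ C`) can be achieved with a left factor `y_M ≡ x ∘ c'_M (mod M)` (`c'_M ∈ C`), then
  `ρ = x ∘ φ` with `φ := x⁻¹ ∘ ρ ∈ C` — an honest product.  (`φ ≡ c'_M ∘ c_M ∈ C (mod M)` at every level and `N₂` is
  closed, `closed_stabilizeIter m 2`.)
* `stub_isProductOfPrincipalLeftFamily` — the registered signature, verbatim.
* Riders: `isProduct_of_frozenLeft` (a frozen left factor gives an honest product — strengthens
  `tripleJoin_eq_top_of_frozenLeft`, which only gave `N₀ ⊔ N₁ ⊔ ρN₂ = ⊤`) and the converse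
  `principalLeftFamily_of_isProduct` (an honest product `x ∘ c` has only principal left-factor families: every
  admissible left factor `y` at level `M` is `≡ x ∘ c' (mod M)` with `c' ∈ C`).
-/

noncomputable section

-- the prescribed namespace `Summit.<P>.<Sub>.…` duplicates `SmoothPoincare4` (P = Sub)
set_option linter.dupNamespace false

namespace Summit.SmoothPoincare4.SmoothPoincare4.Theorems.HeegaardHandlebodyCongruenceClosed.PairRigidityRetraction

open Literature.Topology.FourManifolds Subgroup

/-! ## Congruence calculus modulo a characteristic subgroup -/

/-- A characteristic subgroup is stable under every automorphism, pointwise. [folklore] -/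
theorem apply_mem_of_characteristic {G : Type*} [Group G] {M : Subgroup G} (hM : M.Characteristic)
    (φ : G ≃* G) {s : G} (hs : s ∈ M) : φ s ∈ M :=
  (Subgroup.characteristic_iff_le_comap.mp hM φ) hs

/-- The stabiliser of a subgroup is closed under inversion: `K.map d = K → K.map d⁻¹ = K`. [folklore] -/
theorem map_symm_eq_of_map_eq {G : Type*} [Group G] {K : Subgroup G} (d : G ≃* G)
    (hd : K.map d.toMonoidHom = K) : K.map d.symm.toMonoidHom = K := by
  have h := Subgroup.comap_map_eq_self_of_injective (f := d.toMonoidHom) d.injective K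
  rw [hd] at h
  rwa [Subgroup.comap_equiv_eq_map_symm'] at h

/-- The stabiliser of a subgroup is closed under composition. [folklore] -/
theorem map_trans_eq_of_map_eq {G : Type*} [Group G] {K : Subgroup G} {c c' : G ≃* G}
    (hc : K.map c.toMonoidHom = K) (hc' : K.map c'.toMonoidHom = K) : K.map (c.trans c').toMonoidHom = K := by
  have : (c.trans c').toMonoidHom = c'.toMonoidHom.comp c.toMonoidHom := rfl
  rw [this, ← Subgroup.map_map, hc, hc']

/-- Congruences compose: `ρ ≡ y ∘ c` and `y ≡ x ∘ c'` (mod `M`) give `ρ ≡ x ∘ c' ∘ c (mod M)`. [folklore] -/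
theorem congr_comp {G : Type*} [Group G] {ρ y x c c' : G ≃* G} {M : Subgroup G}
    (h₁ : ∀ s, ρ s * (y (c s))⁻¹ ∈ M) (h₂ : ∀ s, y s * (x (c' s))⁻¹ ∈ M) :
    ∀ s, ρ s * (x (c' (c s)))⁻¹ ∈ M := fun s => by
  have : ρ s * (x (c' (c s)))⁻¹ = (ρ s * (y (c s))⁻¹) * (y (c s) * (x (c' (c s)))⁻¹) := by group
  rw [this]
  exact mul_mem (h₁ s) (h₂ (c s))

/-- Left division of a congruence by an automorphism, pointwise: `a ≡ x b (mod M)` gives `x⁻¹ a ≡ b (mod M)` for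
characteristic `M`. [folklore] -/
theorem symm_apply_mul_inv_mem {G : Type*} [Group G] {M : Subgroup G} (hM : M.Characteristic) (x : G ≃* G)
    {a b : G} (h : a * (x b)⁻¹ ∈ M) : x.symm a * b⁻¹ ∈ M := by
  simpa [map_mul, map_inv] using apply_mem_of_characteristic hM x.symm h

/-- Congruences pass to inverses: `φ ≡ d (mod M)` gives `φ⁻¹ ≡ d⁻¹ (mod M)` for characteristic `M`. [folklore] -/
theorem congr_symm {G : Type*} [Group G] {φ d : G ≃* G} {M : Subgroup G} (hM : M.Characteristic)
    (h : ∀ s, φ s * (d s)⁻¹ ∈ M) : ∀ s, φ.symm s * (d.symm s)⁻¹ ∈ M := fun s => by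
  -- at `u := φ⁻¹ s`: `s * (d (φ⁻¹ s))⁻¹ ∈ M`; apply `d⁻¹` and invert
  have h₁ : s * (d (φ.symm s))⁻¹ ∈ M := by simpa using h (φ.symm s)
  have h₂ : d.symm s * (φ.symm s)⁻¹ ∈ M := by
    simpa [map_mul, map_inv] using apply_mem_of_characteristic hM d.symm h₁
  simpa [mul_inv_rev] using inv_mem h₂

/-! ## Closed subgroups: level-wise congruence to the stabiliser forces membership in the stabiliser -/

/-- If `K` is closed in the characteristic profinite topology of `G` and `φ` is congruent, at every characteristic
finite-index level `M`, to some `d_M` with `d_M(K) = K`, then `φ(K) ≤ K`. [folklore] -/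
theorem map_le_of_congr_of_closed {G : Type*} [Group G] {K : Subgroup G}
    (hcl : ∀ s : G, (∀ M : Subgroup G, M.Characteristic → M.FiniteIndex → s ∈ K ⊔ M) → s ∈ K)
    {φ : G ≃* G}
    (h : ∀ M : Subgroup G, M.Characteristic → M.FiniteIndex →
      ∃ d : G ≃* G, K.map d.toMonoidHom = K ∧ ∀ s, φ s * (d s)⁻¹ ∈ M) :
    K.map φ.toMonoidHom ≤ K := by
  rintro _ ⟨t, ht, rfl⟩
  refine hcl _ fun M hM hF => ?_
  obtain ⟨d, hd, hs⟩ := h M hM hF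
  have : φ t = (φ t * (d t)⁻¹) * d t := by group
  rw [MulEquiv.coe_toMonoidHom, this]
  exact mul_mem (mem_sup_right (hs t)) (mem_sup_left (hd.le ⟨t, ht, rfl⟩))

/-- If `K` is closed in the characteristic profinite topology of `G` and `φ` is congruent, at every characteristic
finite-index level `M`, to some `d_M` with `d_M(K) = K`, then `φ(K) = K` (apply the previous lemma to `φ` and to
`φ⁻¹ ≡ d_M⁻¹`). [folklore] -/
theorem map_eq_of_congr_of_closed {G : Type*} [Group G] {K : Subgroup G}
    (hcl : ∀ s : G, (∀ M : Subgroup G, M.Characteristic → M.FiniteIndex → s ∈ K ⊔ M) → s ∈ K)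
    {φ : G ≃* G}
    (h : ∀ M : Subgroup G, M.Characteristic → M.FiniteIndex →
      ∃ d : G ≃* G, K.map d.toMonoidHom = K ∧ ∀ s, φ s * (d s)⁻¹ ∈ M) :
    K.map φ.toMonoidHom = K := by
  refine le_antisymm (map_le_of_congr_of_closed hcl h) fun t ht => ?_
  have hsymm : K.map φ.symm.toMonoidHom ≤ K :=
    map_le_of_congr_of_closed hcl fun M hM hF => by
      obtain ⟨d, hd, hs⟩ := h M hM hF
      exact ⟨d.symm, map_symm_eq_of_map_eq d hd, congr_symm hM hs⟩
  rw [Subgroup.mem_map_equiv]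
  exact hsymm ⟨t, ht, rfl⟩

/-! ## The left criterion -/

/-- **Left criterion (principal left-factor families are products).** Let `x ∈ H = Stab N₀ ∩ Stab N₁`.  Suppose that
at every characteristic finite-index level `M` there are `y`, `c, c' ∈ C = Stab N₂` with `ρ ≡ y ∘ c (mod M)` and
`y ≡ x ∘ c' (mod M)`.  Then `ρ = x ∘ φ` on the nose with `φ := x⁻¹ ∘ ρ ∈ C`: indeed `φ ≡ c' ∘ c ∈ C (mod M)` at every
level, so `φ(N₂) = N₂` because `N₂` is closed (`closed_stabilizeIter m 2`). [folklore] -/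
theorem isProduct_of_principalLeftFamily {m : ℕ} {ρ : SurfaceGroup (3 + 3 * m) ≃* SurfaceGroup (3 + 3 * m)}
    (x : SurfaceGroup (3 + 3 * m) ≃* SurfaceGroup (3 + 3 * m))
    (hx0 : (s4Kernels.stabilizeIter m 0).map x.toMonoidHom = s4Kernels.stabilizeIter m 0)
    (hx1 : (s4Kernels.stabilizeIter m 1).map x.toMonoidHom = s4Kernels.stabilizeIter m 1)
    (h : ∀ M : Subgroup (SurfaceGroup (3 + 3 * m)), M.Characteristic → M.FiniteIndex →
      ∃ y c c' : SurfaceGroup (3 + 3 * m) ≃* SurfaceGroup (3 + 3 * m),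
        (s4Kernels.stabilizeIter m 0).map y.toMonoidHom = s4Kernels.stabilizeIter m 0 ∧
        (s4Kernels.stabilizeIter m 1).map y.toMonoidHom = s4Kernels.stabilizeIter m 1 ∧
        (s4Kernels.stabilizeIter m 2).map c.toMonoidHom = s4Kernels.stabilizeIter m 2 ∧
        (s4Kernels.stabilizeIter m 2).map c'.toMonoidHom = s4Kernels.stabilizeIter m 2 ∧
        (∀ s, ρ s * (y (c s))⁻¹ ∈ M) ∧ ∀ s, y s * (x (c' s))⁻¹ ∈ M) :
    ∃ x c : SurfaceGroup (3 + 3 * m) ≃* SurfaceGroup (3 + 3 * m),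
      (s4Kernels.stabilizeIter m 0).map x.toMonoidHom = s4Kernels.stabilizeIter m 0 ∧
      (s4Kernels.stabilizeIter m 1).map x.toMonoidHom = s4Kernels.stabilizeIter m 1 ∧
      (s4Kernels.stabilizeIter m 2).map c.toMonoidHom = s4Kernels.stabilizeIter m 2 ∧
      ∀ s, ρ s = x (c s) := by
  refine ⟨x, ρ.trans x.symm, hx0, hx1, ?_, fun s => by simp⟩
  refine map_eq_of_congr_of_closed (closed_stabilizeIter m 2) fun M hM hF => ?_
  obtain ⟨y, c, c', -, -, hc, hc', h₁, h₂⟩ := h M hM hF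
  refine ⟨c.trans c', map_trans_eq_of_map_eq hc hc', fun s => ?_⟩
  show x.symm (ρ s) * (c' (c s))⁻¹ ∈ M
  exact symm_apply_mul_inv_mem hM x (congr_comp h₁ h₂ s)

/-- **Registered stub `stub_isProductOfPrincipalLeftFamily` of line `pair-rigidity-retraction`** (signature verbatim
as registered on stmt-SmoothPoincare4-14596): the left criterion `= isProduct_of_principalLeftFamily`. [folklore] -/
theorem stub_isProductOfPrincipalLeftFamily : ∀ (m : ℕ) (ρ x : Literature.Topology.FourManifolds.SurfaceGroup (3 + 3 * m) ≃* Literature.Topology.FourManifolds.SurfaceGroup (3 + 3 * m)), (Literature.Topology.FourManifolds.s4Kernels.stabilizeIter m 0).map x.toMonoidHom = Literature.Topology.FourManifolds.s4Kernels.stabilizeIter m 0 → (Literature.Topology.FourManifolds.s4Kernels.stabilizeIter m 1).map x.toMonoidHom = Literature.Topology.FourManifolds.s4Kernels.stabilizeIter m 1 → (∀ M : Subgroup (Literature.Topology.FourManifolds.SurfaceGroup (3 + 3 * m)), M.Characteristic → M.FiniteIndex → ∃ y c c' : Literature.Topology.FourManifolds.SurfaceGroup (3 + 3 * m) ≃*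 Literature.Topology.FourManifolds.SurfaceGroup (3 + 3 * m), (Literature.Topology.FourManifolds.s4Kernels.stabilizeIter m 0).map y.toMonoidHom = Literature.Topology.FourManifolds.s4Kernels.stabilizeIter m 0 ∧ (Literature.Topology.FourManifolds.s4Kernels.stabilizeIter m 1).map y.toMonoidHom = Literature.Topology.FourManifolds.s4Kernels.stabilizeIter m 1 ∧ (Literature.Topology.FourManifolds.s4Kernels.stabilizeIter m 2).map c.toMonoidHom = Literature.Topology.FourManifolds.s4Kernels.stabilizeIter m 2 ∧ (Literature.Topology.FourManifolds.s4Kernels.stabilizeIter m 2).map c'.toMonoidHom = Literature.Topology.FourManifolds.s4Kernels.stabilizeIter m 2 ∧ (∀ s, ρ s * (y (c s))⁻¹ ∈ M) ∧ ∀ s, y s * (x (c' s))⁻¹ ∈ M) → ∃ x c : Literature.Topology.FourManifolds.SurfaceGroup (3 + 3 * m) ≃* Literature.Topology.FourManifolds.SurfaceGroup (3 + 3 * m), (Literature.Topology.FourManifolds.s4Kernels.stabilizeIter m 0).map x.toMonoidHom = Literature.Topology.FourManifolds.s4Kernels.stabilizeIter m 0 ∧ (Literature.Topology.FourManifolds.s4Kernels.stabilizeIter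 m 1).map x.toMonoidHom = Literature.Topology.FourManifolds.s4Kernels.stabilizeIter m 1 ∧ (Literature.Topology.FourManifolds.s4Kernels.stabilizeIter m 2).map c.toMonoidHom = Literature.Topology.FourManifolds.s4Kernels.stabilizeIter m 2 ∧ ∀ s, ρ s = x (c s) :=
  fun _ _ x hx0 hx1 h => isProduct_of_principalLeftFamily x hx0 hx1 h

/-! ## Riders: the frozen left factor; the converse -/

/-- **A frozen left factor gives an honest product.** If ONE `x ∈ H` serves at every characteristic finite-index
level (`ρ ≡ x ∘ c_M (mod M)` with `c_M ∈ C`), then `ρ = x' ∘ c` with `x' ∈ H`, `c ∈ C` (namely `x' = x`,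
`c = x⁻¹ ∘ ρ`).  The special case `y := x`, `c' := 1` of the left criterion; it strengthens
`tripleJoin_eq_top_of_frozenLeft` (which only concluded `N₀ ⊔ N₁ ⊔ ρN₂ = ⊤`). [folklore] -/
theorem isProduct_of_frozenLeft {m : ℕ} {ρ : SurfaceGroup (3 + 3 * m) ≃* SurfaceGroup (3 + 3 * m)}
    (x : SurfaceGroup (3 + 3 * m) ≃* SurfaceGroup (3 + 3 * m))
    (hx0 : (s4Kernels.stabilizeIter m 0).map x.toMonoidHom = s4Kernels.stabilizeIter m 0)
    (hx1 : (s4Kernels.stabilizeIter m 1).map x.toMonoidHom = s4Kernels.stabilizeIter m 1)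
    (h : ∀ M : Subgroup (SurfaceGroup (3 + 3 * m)), M.Characteristic → M.FiniteIndex →
      ∃ c : SurfaceGroup (3 + 3 * m) ≃* SurfaceGroup (3 + 3 * m),
        (s4Kernels.stabilizeIter m 2).map c.toMonoidHom = s4Kernels.stabilizeIter m 2 ∧
        ∀ s, ρ s * (x (c s))⁻¹ ∈ M) :
    ∃ x c : SurfaceGroup (3 + 3 * m) ≃* SurfaceGroup (3 + 3 * m),
      (s4Kernels.stabilizeIter m 0).map x.toMonoidHom = s4Kernels.stabilizeIter m 0 ∧
      (s4Kernels.stabilizeIter m 1).map x.toMonoidHom = s4Kernels.stabilizeIter m 1 ∧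
      (s4Kernels.stabilizeIter m 2).map c.toMonoidHom = s4Kernels.stabilizeIter m 2 ∧
      ∀ s, ρ s = x (c s) := by
  refine isProduct_of_principalLeftFamily x hx0 hx1 fun M hM hF => ?_
  obtain ⟨c, hc, hs⟩ := h M hM hF
  refine ⟨x, c, MulEquiv.refl _, hx0, hx1, hc, ?_, hs, fun s => ?_⟩
  · ext s
    simp
  · simp [one_mem]

/-- **Conversely, an honest product has only principal left-factor families.** If `ρ = x ∘ c` with `c ∈ C`, then for
every subgroup `M` and every admissible pair `(y, c₁)` at `M` (`c₁ ∈ C`, `ρ ≡ y ∘ c₁ (mod M)`) the left factor `y` is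
`≡ x ∘ c' (mod M)` for some `c' ∈ C`, namely `c' := c ∘ c₁⁻¹` (evaluate the congruence at `c₁⁻¹ s` and invert).
Neither `x, y ∈ H` nor any hypothesis on `M` is needed. [folklore] -/
theorem principalLeftFamily_of_isProduct {m : ℕ} {ρ : SurfaceGroup (3 + 3 * m) ≃* SurfaceGroup (3 + 3 * m)}
    (x c : SurfaceGroup (3 + 3 * m) ≃* SurfaceGroup (3 + 3 * m))
    (hc : (s4Kernels.stabilizeIter m 2).map c.toMonoidHom = s4Kernels.stabilizeIter m 2)
    (hρ : ∀ s, ρ s = x (c s)) (M : Subgroup (SurfaceGroup (3 + 3 * m)))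
    (y c₁ : SurfaceGroup (3 + 3 * m) ≃* SurfaceGroup (3 + 3 * m))
    (hc₁ : (s4Kernels.stabilizeIter m 2).map c₁.toMonoidHom = s4Kernels.stabilizeIter m 2)
    (h : ∀ s, ρ s * (y (c₁ s))⁻¹ ∈ M) :
    ∃ c' : SurfaceGroup (3 + 3 * m) ≃* SurfaceGroup (3 + 3 * m),
      (s4Kernels.stabilizeIter m 2).map c'.toMonoidHom = s4Kernels.stabilizeIter m 2 ∧
      ∀ s, y s * (x (c' s))⁻¹ ∈ M := by
  refine ⟨c₁.symm.trans c, map_trans_eq_of_map_eq (map_symm_eq_of_map_eq c₁ hc₁) hc, fun s => ?_⟩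
  have h₁ : x (c (c₁.symm s)) * (y s)⁻¹ ∈ M := by simpa [hρ] using h (c₁.symm s)
  simpa [mul_inv_rev] using inv_mem h₁

/-- The converse in the registered-signature style (`∀ m ρ x c, x ∈ H → c ∈ C → ρ = x ∘ c → ∀ M` level `→ ∀ y c₁`
admissible at `M`, `∃ c' ∈ C, y ≡ x ∘ c' (mod M)`), `= principalLeftFamily_of_isProduct`. [folklore] -/
theorem principalLeftFamily_of_isProduct' :
    ∀ (m : ℕ) (ρ x c : SurfaceGroup (3 + 3 * m) ≃* SurfaceGroup (3 + 3 * m)),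
      (s4Kernels.stabilizeIter m 0).map x.toMonoidHom = s4Kernels.stabilizeIter m 0 →
      (s4Kernels.stabilizeIter m 1).map x.toMonoidHom = s4Kernels.stabilizeIter m 1 →
      (s4Kernels.stabilizeIter m 2).map c.toMonoidHom = s4Kernels.stabilizeIter m 2 →
      (∀ s, ρ s = x (c s)) →
      ∀ M : Subgroup (SurfaceGroup (3 + 3 * m)), M.Characteristic → M.FiniteIndex →
      ∀ y c₁ : SurfaceGroup (3 + 3 * m) ≃* SurfaceGroup (3 + 3 * m),
        (s4Kernels.stabilizeIter m 2).map c₁.toMonoidHom = s4Kernels.stabilizeIter m 2 →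
        (∀ s, ρ s * (y (c₁ s))⁻¹ ∈ M) →
        ∃ c' : SurfaceGroup (3 + 3 * m) ≃* SurfaceGroup (3 + 3 * m),
          (s4Kernels.stabilizeIter m 2).map c'.toMonoidHom = s4Kernels.stabilizeIter m 2 ∧
          ∀ s, y s * (x (c' s))⁻¹ ∈ M :=
  fun _ _ x c _ _ hc hρ M _ _ y c₁ hc₁ h => principalLeftFamily_of_isProduct x c hc hρ M y c₁ hc₁ h

/-- The frozen-left rider in the registered-signature style, `= isProduct_of_frozenLeft`. [folklore] -/
theorem isProduct_of_frozenLeft' :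
    ∀ (m : ℕ) (ρ x : SurfaceGroup (3 + 3 * m) ≃* SurfaceGroup (3 + 3 * m)),
      (s4Kernels.stabilizeIter m 0).map x.toMonoidHom = s4Kernels.stabilizeIter m 0 →
      (s4Kernels.stabilizeIter m 1).map x.toMonoidHom = s4Kernels.stabilizeIter m 1 →
      (∀ M : Subgroup (SurfaceGroup (3 + 3 * m)), M.Characteristic → M.FiniteIndex →
        ∃ c : SurfaceGroup (3 + 3 * m) ≃* SurfaceGroup (3 + 3 * m),
          (s4Kernels.stabilizeIter m 2).map c.toMonoidHom = s4Kernels.stabilizeIter m 2 ∧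
          ∀ s, ρ s * (x (c s))⁻¹ ∈ M) →
      ∃ x c : SurfaceGroup (3 + 3 * m) ≃* SurfaceGroup (3 + 3 * m),
        (s4Kernels.stabilizeIter m 0).map x.toMonoidHom = s4Kernels.stabilizeIter m 0 ∧
        (s4Kernels.stabilizeIter m 1).map x.toMonoidHom = s4Kernels.stabilizeIter m 1 ∧
        (s4Kernels.stabilizeIter m 2).map c.toMonoidHom = s4Kernels.stabilizeIter m 2 ∧
        ∀ s, ρ s = x (c s) :=
  fun _ _ x hx0 hx1 h => isProduct_of_frozenLeft x hx0 hx1 h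

end Summit.SmoothPoincare4.SmoothPoincare4.Theorems.HeegaardHandlebodyCongruenceClosed.PairRigidityRetraction

end
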